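import Literature.MathematicalPhysics.QuantumFieldTheory.Balaban1983to89.B12Ward59

/-!
# Bałaban CMP 109 (1987) §4 pp. 282–284: the gauge invariance (4.7) of the functional `𝐄`, DIFFERENTIATED — (4.7) ⇒
the fundamental identity (4.9) ⇒ «For constant λ» (4.13) ⇒ the first Ward–Takahashi identity (4.15)₁ at `B = 0` in
the exponential chart `V = exp iB`, i.e. the hypothesis `h415` of the lineage's `…B12Ward59` DISCHARGED from the
concrete gauge action `V^v(b) = v(b₋)V(b)v⁻¹(b₊)` (with (4.14) `(δ/δB)𝐄(1) = 0` a NAMED HYPOTHESIS)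

CITATION HEADER (lean-in-tree rule 2026-08-18).
* Source: T. Bałaban, "Renormalization group approach to lattice gauge field theories. I. Generation of effective
  actions in a small field approximation and a coupling constant renormalization in four dimensions", Commun. Math.
  Phys. **109** (1987) 249–301, doi:10.1007/bf01215223 [Balaban1987RG1] (cell paper B12; held:
  `paper:balaban1987-cmp109-rg-i-small-field`; PDF page = journal page − 248), §4 pp. 282–284, displays
  (4.7)–(4.9), (4.13)–(4.15).  The sentences and displays quoted below were READ AS IMAGES by the author of this file
  on the 300-dpi renders of the audit cell (`HOME/b2b-balaban-ref1/pages/1987-cmp109-rg-I-small-field/…-p034-x2.png`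
  = p. 282, `…-p035-x2.png` = p. 283, `…-p036-x2.png` = p. 284; HOME = the cell folder
  `run/shared/lean/pub/pub-balaban/`) and agree with the lineage transcript `HOME/b2b-balaban-b03/B12s-transcript.md`
  ((4.7)–(4.11) at its lines 539–575); inside quotation marks nothing is altered.  Audit cell `pub-balaban`, unit
  `b2b-balaban-b03-g20` (PAPER SUB-CELL B03 → B12 §§2–5 lineage, gen 20), node B12-GAUGE-47.  Imports only the
  lineage's own accepted module `…B12Ward59` (gen 19: the ABSTRACT chain (4.9) + (4.14) ⇒ (4.15)₁
  `h415_of_gaugeGenerators` over generator fields `X_λ` given as data, and (4.15)₁ + (5.1) + (5.2) ⇒ (5.9)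
  `eq59_of_limit_of_gaugeInvariance`; through it `…B12Ward414` (gen 5: `ward_first_order`,
  `fderiv_comp_generator_eq_zero`, `fderiv_eq_zero_of_generators`) and Mathlib's `NormedSpace.exp`); modifies
  nothing.
* Statements reproduced (verbatim).  p. 282 [PDF 34]: *"The tools to investigate the sum in (4.6) are provided by a
  set of Ward-Takahashi identities. They express gauge invariance of a considered function. Take a function 𝐄(V)
  defined and analytic on a domain of small gauge field configurations V on a unit lattice, and assume that it is
  gauge invariant, i.e.,"* (4.7) *"𝐄(V^v) = 𝐄(V), V^v(b) = v(b₋)V(b)v⁻¹(b₊)."*  p. 283 [PDF 35]: *"We assume the gauge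
  invariance with respect to G^c-valued gauge transformations, but it is implied by the invariance with respect to
  G-valued transformations, and by the analyticity of the function, as it was noticed already. For a small gauge
  field V = exp iB, and a small gauge transformation v = exp iλ, B and λ small, we have"* (4.8) *"V^v(b) =
  exp iλ(b₋) exp iB(b) exp(−iλ(b₊)) = …, (1/i) log V^v(b) = … = B(b) + i[λ(b₋), B(b)] − g⁻¹(iad_{B(b)})(∂λ)(b) + …,
  where the dots denote terms of higher order in λ, and g⁻¹(z) = (−z)/(e^{−z} − 1) = 1 + ½z + k₂z² + …."*  *"Now
  differentiate the equality (4.7) with respect to λ, at λ = 0. This gives the identity"* (4.9)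
  *"⟨(δ/δB)𝐄(exp iB), i[λ(b₋), B(b)] − g⁻¹(iad_{B(b)})(∂λ)(b)⟩ = 0 holding for all 𝔤^c-valued functions λ, and
  small, 𝔤^c-valued configurations B. It is the fundamental identity expressing the gauge invariance of the function
  𝐄."*  p. 284 [PDF 36]: *"We are interested in the above identities at B = 0, because such expressions only appear
  in the sum (4.6). This simplifies them in an essential way. Consider at first (4.10) at B = 0"* (4.13)
  *"⟨(δ²/δB²)𝐄(1), −∂λ, B₁⟩ + ⟨(δ/δB)𝐄(1), iad_{λ₋}B₁ − ½iad_{B₁}∂λ⟩ = 0.  For constant λ we get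
  ⟨(δ/δB)𝐄(1), iad_λB₁⟩ = 0, and since the configuration B₁ is arbitrary, we get [λ, (δ/δB)𝐄(1)] = 0 for all
  λ ∈ 𝔤^c. The group G is semisimple, hence this is possible only for the element 0 in the algebra 𝔤^c. Thus we
  have the first, very important consequence of the gauge invariance"* (4.14) *"(δ/δB)𝐄(1) = 0.  This equality
  simplifies the identities, and also the sum (4.6), we can drop the term with n = 1. We obtain the following set of
  Ward-Takahashi identities"* (4.15)₁ *"⟨(δ²/δB²)𝐄(1), B₁, ∂λ⟩ = 0, … for an arbitrary gauge function λ, and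
  arbitrary gauge fields B₁, B₂, B₃."*  And the bond convention, p. 284: *"The field B_μ(x) = B(x, x + e_μ) = …"*.
* Dictionary print → Lean (the only modelling choices; all bookkeeping, no analysis).  The gauge field on the bonds
  `b = (x, x + e_ν)` of a finite torus `T` (`b₋ = x`, `b₊ = x + e_ν`, shifts `e : Λ → T`, directions `ν : Λ`) is
  `W : Λ → T → 𝔄` with values in a complete normed real algebra `𝔄` (print: `V = exp iB ∈ G^c ⊂ M_N(ℂ)`; the
  factor `i` of `exp iB`, `exp iλ` is absorbed into `B`, `λ`, which changes nothing in the identities at `B = 0`);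
  the gauge transformation `v = exp(tλ)`, `λ : T → 𝔄`, acts by (4.7)/(4.8) `W ↦ (exp(tλ(x)) W_ν(x)
  exp(−tλ(x + e_ν)))_{ν,x}` (Mathlib's `NormedSpace.exp`); its generator at `t = 0` is the linear field
  `W ↦ (λ(b₋)W(b) − W(b)λ(b₊))_b` (`hasDerivAt_gaugeFlow`, `exists_generatorCLM`), equal to `−∂λ` at `W = 1`, where
  as in `…B12Ward59` `(∂λ)_ν(y) = λ(y + e_ν) − λ(y)`; the functional is `ℰ : (Λ → T → 𝔄) → F` (print's 𝐄), (4.7) is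
  the hypothesis `h47 : ∀ λ, ∀ᶠ W in 𝓝 1, ∀ᶠ t in 𝓝 0, ℰ (W^{exp(tλ)}) = ℰ W`, «analytic» is weakened to `C²` at
  `V = 1`, and the chart `V = exp iB` is `B ↦ (exp B_ν(x))_{ν,x}`.  The module is DEFINITION-FREE: flow, generator
  and chart are written out as lambdas in every statement.  Print differentiates in the chart `B`; here
  the first-order identity is derived in the field `V` itself (the generator `λ₋V − Vλ₊` is the tangent vector that
  print writes through `d log` as `i[λ₋, B] − g⁻¹(iad_B)∂λ`), and the passage to the chart is made only at `B = 0`,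
  where `d exp(0) = id` and, by (4.14), the second derivative of the chart drops out (`hessian_comp_expChart_zero`) —
  so the END STATEMENT `h415_of_gaugeInvariance` is literally print's (4.15)₁ for `B ↦ 𝐄(exp iB)` at `B = 0`, in the
  exact shape of the hypothesis `h415` of `…B12Ward59`.

WHAT IS PROVED (kernel-checked, no `sorry`, standard axioms, NO definitions; bookkeeping theorems, every analytic
input a NAMED HYPOTHESIS):
* §1 `hasDerivAt_gaugeFlow` — the flow (4.8) has `t`-derivative `(λ(b₋)W(b) − W(b)λ(b₊))_b` at `t = 0`
  (`exists_generatorCLM`: the generator is continuous linear in `W`; `gaugeFlow_zero`: `v_0 = 1` acts trivially);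
  `fderiv_apply_gaugeGenerator_eq_zero` — **(4.7) ⇒ (4.9)**: differentiability of `ℰ` at `W` + invariance under the
  flow for small `t` ⇒ `Dℰ(W)[λ₋W − Wλ₊] = 0`.
* §2 `fderiv_one_apply_ad_eq_zero` — **(4.13) «For constant λ»**: `Dℰ(1)[l·v − v·l] = 0`;
  `fderiv_one_eq_zero_of_gaugeInvariance` — **(4.14) under the detecting hypothesis** `hspan` (see its caveat);
  `hessian_one_apply_grad_eq_zero` — **(4.7) + (4.14) ⇒ (4.15)₁ in `V`-coordinates**: `D²ℰ(1)(B₁, ∂λ) = 0`.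
* §3 `expChart_zero`, `contDiff_expChart`, `hasFDerivAt_expChart_zero` (`d exp i·|₀ = id`), `contDiff_comp_expChart`,
  `hessian_comp_expChart_zero` — given (4.14), `D²(ℰ ∘ exp)(0) = D²ℰ(1)`; `h415_of_gaugeInvariance` — **(4.7) +
  (4.14) ⇒ (4.15)₁ at `B = 0` for
  `B ↦ ℰ(exp iB)`**, i.e. the hypothesis `h415` of `…B12Ward59.ward59_of_limit_of_gaugeInvariance` /
  `eq59_of_limit_of_gaugeInvariance` / `moment2_eq_of_limit_of_gaugeInvariance` and of
  `…B12Rep538Limit.*_of_limit_of_gaugeInvariance` DISCHARGED from the concrete gauge action.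
* §4 `eq59_of_limit_of_gaugeInvariance47` — the by-name composition: per-volume functionals `ℰ n` of the gauge field,
  `C²`, translation invariant (5.2), gauge invariant near `V = 1` (4.7), with (4.14); `Πv n` the Hessian kernel of
  `B ↦ ℰ n(exp iB)` at `B = 0` ((5.1)'s object «(δ²/δB²)𝐄(U(exp iB))|_{B=0}»); the limit (5.1) ⇒ (5.9)₁,₂ for the
  limit tensor and their complex readings `WardB`, `WardB₂`.

WHAT IS NOT PROVED HERE (and not claimed): (4.14) itself for `𝔤^c`-valued fields from semisimplicity (print's
one-line argument; the associative typing here keeps it as the hypothesis `h414` — for a full matrix algebra the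
commutator directions do not detect the trace part, see `fderiv_one_eq_zero_of_gaugeInvariance`); the higher
identities (4.10)–(4.12), (4.15)₂,₃ (they need the `B`-dependent generator `i[λ₋, B] − g⁻¹(iad_B)∂λ`, i.e. `d log`
away from `0`; the abstract second/third-order machinery is `…B12Ward414.ward_second_order`, `ward_third_order`);
the existence, analyticity and invariance of print's effective actions `𝐄^{(j)}` (B12 §§2–3, the renormalization
group construction) and the limit (5.1) — exactly the named hypotheses of the parents; nothing about B13 or the
continuum limit.

HONEST FRAMING: value = the lineage's Ward hypothesis `h415` is no longer a free-standing assumption about a Hessian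
but a kernel-checked CONSEQUENCE of the two structural inputs print actually uses — gauge invariance (4.7) of the
functional under the concrete action `V ↦ v(b₋)V(b)v⁻¹(b₊)` and (4.14) — with the calculus ((4.8) to first order,
the chain rule at `B = 0`) done in Lean over Mathlib's exponential; one more printed implication of B12 §4 made
by-name composable.  NOT summit progress: bookkeeping of printed displays; every analytic statement remains a
hypothesis.
-/

namespace Literature.MathematicalPhysics.QuantumFieldTheory.Balaban1983to89.B12GaugeInv47

open Literature.MathematicalPhysics.QuantumFieldTheory.GawedzkiKupiainen1985.PeriodicGleason (Pt unitVec)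
open Literature.MathematicalPhysics.QuantumFieldTheory.Balaban1983to89.B12Transverse536 (WardFirst WardB)
open Literature.MathematicalPhysics.QuantumFieldTheory.Balaban1983to89.B12WardLeadingForm (WardB₂)
open Literature.MathematicalPhysics.QuantumFieldTheory.Balaban1983to89.B12Form543 (ofRealK)
open Literature.MathematicalPhysics.QuantumFieldTheory.Balaban1983to89.B12Ward414 (fderiv_comp_generator_eq_zero
  fderiv_eq_zero_of_generators)
open Literature.MathematicalPhysics.QuantumFieldTheory.Balaban1983to89.B12Ward59 (h415_of_gaugeGenerators
  ward59_of_limit_of_gaugeInvariance eq59_of_limit_of_gaugeInvariance)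
open NormedSpace (exp exp_zero exp_analytic)
open Filter
open _root_.Topology

/-! ## §1. (4.7) ⇒ (4.9): the gauge flow, its generator, and the first-order identity in `V`-coordinates

The one-parameter gauge transformation `v_t = exp(tλ)` acts on a bond field `W : Λ → T → 𝔄` by (4.7)/(4.8)
«V^v(b) = v(b₋)V(b)v⁻¹(b₊)», «V^v(b) = exp iλ(b₋) exp iB(b) exp(−iλ(b₊))»: on the bond `b = (x, x + e_ν)`
(`b₋ = x`, `b₊ = x + e_ν`; p. 284 «B_μ(x) = B(x, x + e_μ)») the field is mapped to
`exp(tλ(x)) · W_ν(x) · exp(−tλ(x + e_ν))`; this module is DEFINITION-FREE, so the flow, its generator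
`W ↦ (λ(b₋)W(b) − W(b)λ(b₊))_b` and the chart `B ↦ (exp B_ν(x))` are written out as lambdas in every statement. -/

section GaugeFlow

variable {𝔄 : Type*} [NormedRing 𝔄] [NormedAlgebra ℝ 𝔄] {Λ T : Type*} [AddCommGroup T]

/-- **The generator of the gauge transformations is a continuous linear map of the field** (used to feed the
abstract Ward machinery of `…B12Ward414`, which wants linear / differentiable generator fields): there is a
continuous linear `L` with `L W = (λ(b₋)W(b) − W(b)λ(b₊))_b`. [folklore] (about (4.8)-(4.9) p.283 of
Balaban1987RG1) -/
theorem exists_generatorCLM (e : Λ → T) (lam : T → 𝔄) :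
    ∃ L : (Λ → T → 𝔄) →L[ℝ] (Λ → T → 𝔄), ∀ W, L W = fun ν x => lam x * W ν x - W ν x * lam (x + e ν) :=
  ⟨ContinuousLinearMap.pi fun ν => ContinuousLinearMap.pi fun x =>
      (ContinuousLinearMap.mul ℝ 𝔄 (lam x) - (ContinuousLinearMap.mul ℝ 𝔄).flip (lam (x + e ν))).comp
        ((ContinuousLinearMap.proj (R := ℝ) (φ := fun _ : T => 𝔄) x).comp
          (ContinuousLinearMap.proj (R := ℝ) (φ := fun _ : Λ => T → 𝔄) ν)),
    fun W => by
      funext ν x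
      simp⟩

/-- `v_0 = 1` acts trivially: the flow at `t = 0` is the field itself. [folklore] -/
theorem gaugeFlow_zero (e : Λ → T) (lam : T → 𝔄) (W : Λ → T → 𝔄) :
    (fun ν x => exp ((0 : ℝ) • lam x) * W ν x * exp (-((0 : ℝ) • lam (x + e ν)))) = W := by
  funext ν x
  simp [exp_zero]

variable [CompleteSpace 𝔄] [Fintype T] {F : Type*} [NormedAddCommGroup F] [NormedSpace ℝ F]

/-- **The gauge flow (4.8) `t ↦ (exp(tλ(b₋)) W(b) exp(−tλ(b₊)))_b` is differentiable at `t = 0` with derivative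
the generator `(λ(b₋)W(b) − W(b)λ(b₊))_b`** (the first line of (4.8) differentiated at `λ = 0` along `tλ`; at
`W = 1` this is `−∂λ`, `(∂λ)_ν(x) = λ(x + e_ν) − λ(x)`, print's «(1/i) log V^v(b) = … B(b) + i[λ(b₋), B(b)] −
g⁻¹(iad_{B(b)})(∂λ)(b) + …» at `B = 0`). [folklore] (about (4.8) p.283 of Balaban1987RG1) -/
theorem hasDerivAt_gaugeFlow (e : Λ → T) (lam : T → 𝔄) (W : Λ → T → 𝔄) :
    HasDerivAt (fun t : ℝ => fun ν x => exp (t • lam x) * W ν x * exp (-(t • lam (x + e ν))))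
      (fun ν x => lam x * W ν x - W ν x * lam (x + e ν)) 0 := by
  refine hasDerivAt_pi.2 fun ν => hasDerivAt_pi.2 fun x => ?_
  have h1 : HasDerivAt (fun t : ℝ => exp (t • lam x)) (lam x * exp ((0 : ℝ) • lam x)) 0 :=
    hasDerivAt_exp_smul_const' (𝕂 := ℝ) (lam x) 0
  have h2 : HasDerivAt (fun t : ℝ => exp (t • -lam (x + e ν)))
      (exp ((0 : ℝ) • -lam (x + e ν)) * -lam (x + e ν)) 0 :=
    hasDerivAt_exp_smul_const (𝕂 := ℝ) (-lam (x + e ν)) 0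
  have h3 := (h1.mul_const (W ν x)).fun_mul h2
  simp only [zero_smul, smul_neg, neg_zero, exp_zero, mul_one, one_mul, mul_neg, ← sub_eq_add_neg] at h3
  exact h3

variable [Fintype Λ]

/-- **(4.7) ⇒ (4.9), in `V`-coordinates** (p. 283 «Now differentiate the equality (4.7) with respect to λ, at
λ = 0. This gives the identity» (4.9) «… It is the fundamental identity expressing the gauge invariance of the
function 𝐄.»): if `𝐄` is differentiable at `W` and invariant under the gauge flow of `λ` for small `t`,
`𝐄(W^{v_t}) = 𝐄(W)`, then `D𝐄(W)[λ(b₋)W(b) − W(b)λ(b₊)] = 0`.  (Print states (4.9) in the chart `V = exp iB`, with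
the generator `i[λ(b₋), B(b)] − g⁻¹(iad_{B(b)})(∂λ)(b)` = the same tangent vector read through `d log`; the two
forms agree by the chain rule, and at `B = 0` literally, `d exp i·|₀ = id`: `hasFDerivAt_expChart_zero`.)
[cite: Balaban1987RG1, (4.7) p.282, (4.9) p.283] -/
theorem fderiv_apply_gaugeGenerator_eq_zero {ℰ : (Λ → T → 𝔄) → F} {W : Λ → T → 𝔄} (e : Λ → T)
    (lam : T → 𝔄) (hℰ : DifferentiableAt ℝ ℰ W)
    (h47 : ∀ᶠ t in 𝓝 (0 : ℝ), ℰ (fun ν x => exp (t • lam x) * W ν x * exp (-(t • lam (x + e ν)))) = ℰ W) :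
    fderiv ℝ ℰ W (fun ν x => lam x * W ν x - W ν x * lam (x + e ν)) = 0 := by
  have hγ := hasDerivAt_gaugeFlow e lam W
  have h1 : HasDerivAt
      (fun t : ℝ => ℰ (fun ν x => exp (t • lam x) * W ν x * exp (-(t • lam (x + e ν)))))
      (fderiv ℝ ℰ W (fun ν x => lam x * W ν x - W ν x * lam (x + e ν))) 0 :=
    hℰ.hasFDerivAt.comp_hasDerivAt_of_eq (0 : ℝ) hγ (gaugeFlow_zero e lam W).symm
  have h2 : HasDerivAt
      (fun t : ℝ => ℰ (fun ν x => exp (t • lam x) * W ν x * exp (-(t • lam (x + e ν))))) 0 0 :=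
    (hasDerivAt_const (0 : ℝ) (ℰ W)).congr_of_eventuallyEq h47
  exact h1.unique h2

/-! ## §2. (4.9) near `V = 1` + (4.14) ⇒ (4.13) «for constant λ» and (4.15)₁, in `V`-coordinates -/

/-- **(4.13) «For constant λ we get ⟨(δ/δB)𝐄(1), iad_λB₁⟩ = 0»** (p. 284), in `V`-coordinates: if `𝐄` is `C²` at
the unit configuration and invariant under the CONSTANT gauge transformations `exp(tl)` near `V = 1` for small `t`,
then `D𝐄(1)[l·v − v·l] = 0` for every direction `v` («since the configuration B₁ is arbitrary») — the generator of
a constant gauge transformation is the LINEAR field `W ↦ lW − Wl` vanishing at `1`, so the `W`-derivative of (4.9)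
at `1` is this identity (`…B12Ward414.fderiv_comp_generator_eq_zero`). [cite: Balaban1987RG1, (4.13) p.284] -/
theorem fderiv_one_apply_ad_eq_zero {ℰ : (Λ → T → 𝔄) → F} (e : Λ → T) (hℰ : ContDiffAt ℝ 2 ℰ 1) (l : 𝔄)
    (h47 : ∀ᶠ W in 𝓝 (1 : Λ → T → 𝔄), ∀ᶠ t in 𝓝 (0 : ℝ),
      ℰ (fun ν x => exp (t • l) * W ν x * exp (-(t • l))) = ℰ W)
    (v : Λ → T → 𝔄) : fderiv ℝ ℰ 1 (fun ν x => l * v ν x - v ν x * l) = 0 := by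
  obtain ⟨L, hL⟩ := exists_generatorCLM e (fun _ : T => l)
  set ℰ₁ : (Λ → T → 𝔄) → F := fun U => ℰ (1 + U) with hℰ₁
  have hD : ∀ U, fderiv ℝ ℰ₁ U = fderiv ℝ ℰ (1 + U) := fun U => fderiv_comp_add_left 1
  have h1C : ContDiffAt ℝ 2 ℰ₁ 0 := by
    have h : ContDiffAt ℝ 2 ℰ ((fun U : Λ → T → 𝔄 => 1 + U) 0) := by simpa using hℰ
    exact h.comp 0 (contDiffAt_const.add contDiffAt_id)
  have hdiff : ∀ᶠ W in 𝓝 (1 : Λ → T → 𝔄), DifferentiableAt ℝ ℰ W := by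
    filter_upwards [hℰ.eventually (by simp)] with W hW
    exact hW.differentiableAt (by simp)
  have hc : Tendsto (fun U : Λ → T → 𝔄 => 1 + U) (𝓝 0) (𝓝 1) := by
    have hcts : Continuous (fun U : Λ → T → 𝔄 => 1 + U) := by fun_prop
    simpa using hcts.tendsto 0
  have hinv : ∀ᶠ U in 𝓝 (0 : Λ → T → 𝔄), fderiv ℝ ℰ₁ U (L U) = 0 := by
    filter_upwards [hc.eventually (hdiff.and h47)] with U hU
    have h := fderiv_apply_gaugeGenerator_eq_zero e (fun _ : T => l) hU.1 hU.2
    have h1 : (fun ν x => l * (1 + U) ν x - (1 + U) ν x * l) = L U := by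
      rw [hL]
      funext ν x
      simp only [Pi.add_apply, Pi.one_apply, mul_add, add_mul, mul_one, one_mul, add_sub_add_left_eq_sub]
    rwa [h1, ← hD] at h
  have h := fderiv_comp_generator_eq_zero L h1C hinv
  have h' : fderiv ℝ ℰ 1 (L v) = 0 := by
    have := congrArg (fun φ : (Λ → T → 𝔄) →L[ℝ] F => φ v) h
    simpa [hD] using this
  rwa [hL] at h'

/-- **(4.14) from (4.13)-for-constant-λ, under a detecting hypothesis** (p. 284 «and since the configuration B₁ is
arbitrary, we get [λ, (δ/δB)𝐄(1)] = 0 for all λ ∈ 𝔤^c. The group G is semisimple, hence this is possible only for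
the element 0 in the algebra 𝔤^c. Thus we have the first, very important consequence of the gauge invariance»
(4.14) «(δ/δB)𝐄(1) = 0.»): if the ranges of the linear generators `v ↦ lv − vl` of the constant gauge
transformations span a dense subspace, (4.14) follows (`…B12Ward414.fderiv_eq_zero_of_generators`).  MODEL CAVEAT:
for fields with values in a full matrix algebra `𝔄 = M_N` the hypothesis `hspan` FAILS (the trace direction is not a
commutator); print's fields are `𝔤^c`-valued with `G` semisimple, where the detecting property is
`…B12Ward414.dense_span_range_of_conj_adConst_of_isSemisimple`; the bridge from that Lie-algebra statement to the
present associative typing is NOT made here, which is why the theorems below keep (4.14) as the NAMED HYPOTHESIS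
`h414`. [cite: Balaban1987RG1, (4.13)-(4.14) p.284] -/
theorem fderiv_one_eq_zero_of_gaugeInvariance {ℰ : (Λ → T → 𝔄) → F} (e : Λ → T) (hℰ : ContDiffAt ℝ 2 ℰ 1)
    (h47 : ∀ l : 𝔄, ∀ᶠ W in 𝓝 (1 : Λ → T → 𝔄), ∀ᶠ t in 𝓝 (0 : ℝ),
      ℰ (fun ν x => exp (t • l) * W ν x * exp (-(t • l))) = ℰ W)
    (hspan : Dense (Submodule.span ℝ
      (⋃ l : 𝔄, Set.range (fun v : Λ → T → 𝔄 => fun ν x => l * v ν x - v ν x * l)) : Set (Λ → T → 𝔄))) :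
    fderiv ℝ ℰ 1 = 0 := by
  choose L hL using fun l : 𝔄 => exists_generatorCLM (Λ := Λ) e (fun _ : T => l)
  set ℰ₁ : (Λ → T → 𝔄) → F := fun U => ℰ (1 + U) with hℰ₁
  have hD : ∀ U, fderiv ℝ ℰ₁ U = fderiv ℝ ℰ (1 + U) := fun U => fderiv_comp_add_left 1
  have h1C : ContDiffAt ℝ 2 ℰ₁ 0 := by
    have h : ContDiffAt ℝ 2 ℰ ((fun U : Λ → T → 𝔄 => 1 + U) 0) := by simpa using hℰ
    exact h.comp 0 (contDiffAt_const.add contDiffAt_id)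
  have hdiff : ∀ᶠ W in 𝓝 (1 : Λ → T → 𝔄), DifferentiableAt ℝ ℰ W := by
    filter_upwards [hℰ.eventually (by simp)] with W hW
    exact hW.differentiableAt (by simp)
  have hc : Tendsto (fun U : Λ → T → 𝔄 => 1 + U) (𝓝 0) (𝓝 1) := by
    have hcts : Continuous (fun U : Λ → T → 𝔄 => 1 + U) := by fun_prop
    simpa using hcts.tendsto 0
  have hinv : ∀ l : 𝔄, ∀ᶠ U in 𝓝 (0 : Λ → T → 𝔄), fderiv ℝ ℰ₁ U (L l U) = 0 := by
    intro l
    filter_upwards [hc.eventually (hdiff.and (h47 l))] with U hU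
    have h := fderiv_apply_gaugeGenerator_eq_zero e (fun _ : T => l) hU.1 hU.2
    have h1 : (fun ν x => l * (1 + U) ν x - (1 + U) ν x * l) = L l U := by
      rw [hL]
      funext ν x
      simp only [Pi.add_apply, Pi.one_apply, mul_add, add_mul, mul_one, one_mul, add_sub_add_left_eq_sub]
    rwa [h1, ← hD] at h
  have hrange : ∀ l : 𝔄,
      Set.range (L l) = Set.range (fun v : Λ → T → 𝔄 => fun ν x => l * v ν x - v ν x * l) := fun l =>
    congrArg Set.range (funext (hL l))
  have hspan' : Dense (Submodule.span ℝ (⋃ l : 𝔄, Set.range (L l)) : Set (Λ → T → 𝔄)) := by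
    rw [Set.iUnion_congr hrange]
    exact hspan
  have h := fderiv_eq_zero_of_generators L h1C hinv hspan'
  rwa [hD, add_zero] at h

/-- **(4.9) near `V = 1` + (4.14) ⇒ (4.15)₁ «⟨(δ²/δB²)𝐄(1), B₁, ∂λ⟩ = 0», in `V`-coordinates** (p. 284): if `𝐄` is
`C²` at `1`, invariant under the gauge flows of every `λ` near `V = 1` for small `t` ((4.7)), and (4.14)
`D𝐄(1) = 0`, then `D²𝐄(1)(u, ∂λ) = 0` for every direction `u = B₁` and gauge function `λ` — the lineage's abstract
chain `…B12Ward59.h415_of_gaugeGenerators` (gen 19) fed with the CONCRETE generator fields `U ↦ L_λ(1 + U)`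
(affine, value `−∂λ` at `U = 0`) and the infinitesimal invariance `fderiv_apply_gaugeGenerator_eq_zero`.
[cite: Balaban1987RG1, (4.7) p.282, (4.9) p.283, (4.14)-(4.15) p.284] -/
theorem hessian_one_apply_grad_eq_zero {ℰ : (Λ → T → 𝔄) → F} (e : Λ → T) (hℰ : ContDiffAt ℝ 2 ℰ 1)
    (h47 : ∀ lam : T → 𝔄, ∀ᶠ W in 𝓝 (1 : Λ → T → 𝔄), ∀ᶠ t in 𝓝 (0 : ℝ),
      ℰ (fun ν x => exp (t • lam x) * W ν x * exp (-(t • lam (x + e ν)))) = ℰ W)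
    (h414 : fderiv ℝ ℰ 1 = 0) (u : Λ → T → 𝔄) (lam : T → 𝔄) :
    fderiv ℝ (fderiv ℝ ℰ) 1 u (fun ν y => lam (y + e ν) - lam y) = 0 := by
  classical
  choose L hL using fun lam' : T → 𝔄 => exists_generatorCLM (Λ := Λ) e lam'
  set ℰ₁ : (Λ → T → 𝔄) → F := fun U => ℰ (1 + U) with hℰ₁
  have hD : ∀ U, fderiv ℝ ℰ₁ U = fderiv ℝ ℰ (1 + U) := fun U => fderiv_comp_add_left 1
  have hD' : fderiv ℝ ℰ₁ = fun U => fderiv ℝ ℰ (1 + U) := funext hD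
  have hDD : fderiv ℝ (fderiv ℝ ℰ₁) 0 = fderiv ℝ (fderiv ℝ ℰ) 1 := by
    rw [hD']
    have h := fderiv_comp_add_left (𝕜 := ℝ) (f := fderiv ℝ ℰ) (x := (0 : Λ → T → 𝔄)) (1 : Λ → T → 𝔄)
    rwa [add_zero] at h
  have h1C : ContDiffAt ℝ 2 ℰ₁ 0 := by
    have h : ContDiffAt ℝ 2 ℰ ((fun U : Λ → T → 𝔄 => 1 + U) 0) := by simpa using hℰ
    exact h.comp 0 (contDiffAt_const.add contDiffAt_id)
  have hdiff : ∀ᶠ W in 𝓝 (1 : Λ → T → 𝔄), DifferentiableAt ℝ ℰ W := by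
    filter_upwards [hℰ.eventually (by simp)] with W hW
    exact hW.differentiableAt (by simp)
  have hc : Tendsto (fun U : Λ → T → 𝔄 => 1 + U) (𝓝 0) (𝓝 1) := by
    have hcts : Continuous (fun U : Λ → T → 𝔄 => 1 + U) := by fun_prop
    simpa using hcts.tendsto 0
  have hX : ∀ lam' : T → 𝔄, DifferentiableAt ℝ (fun U : Λ → T → 𝔄 => L lam' (1 + U)) 0 :=
    fun lam' => (L lam').differentiableAt.comp 0 ((differentiableAt_const _).add differentiableAt_id)
  have hX0 : ∀ lam' : T → 𝔄, (fun U : Λ → T → 𝔄 => L lam' (1 + U)) 0 =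
      -(fun ν y => lam' (y + e ν) - lam' y) := by
    intro lam'
    simp only [add_zero, hL]
    funext ν y
    simp
  have hinv : ∀ lam' : T → 𝔄, ∀ᶠ U in 𝓝 (0 : Λ → T → 𝔄), fderiv ℝ ℰ₁ U (L lam' (1 + U)) = 0 := by
    intro lam'
    filter_upwards [hc.eventually (hdiff.and (h47 lam'))] with U hU
    rw [hD, hL]
    exact fderiv_apply_gaugeGenerator_eq_zero e lam' hU.1 hU.2
  have h414₁ : fderiv ℝ ℰ₁ 0 = 0 := by rw [hD, add_zero, h414]
  have h := h415_of_gaugeGenerators (𝕜 := ℝ) h1C e (fun lam' U => L lam' (1 + U)) hX hX0 hinv h414₁ u lam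
  rwa [hDD] at h

end GaugeFlow

/-! ## §3. The exponential chart `V = exp iB`: (4.15)₁ at `B = 0` for `B ↦ 𝐄(exp iB)` -/

section Chart

variable {𝔄 : Type*} [NormedRing 𝔄] {Λ T : Type*}

/-- `exp i0 = 1`: the chart `B ↦ (exp B_ν(x))` (print: `V = exp iB`, the factor `i` absorbed) at `B = 0`.
[folklore] -/
theorem expChart_zero : (fun ν x => exp ((0 : Λ → T → 𝔄) ν x)) = (1 : Λ → T → 𝔄) := by
  funext ν x
  simp [exp_zero]

variable [NormedAlgebra ℝ 𝔄] [CompleteSpace 𝔄] [Fintype Λ] [Fintype T] {F : Type*} [NormedAddCommGroup F]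
  [NormedSpace ℝ F]

/-- The exponential chart `B ↦ (exp B_ν(x))_{ν,x}` is smooth. [folklore] -/
theorem contDiff_expChart {n : WithTop ℕ∞} : ContDiff ℝ n (fun B : Λ → T → 𝔄 => fun ν x => exp (B ν x)) := by
  refine contDiff_pi.2 fun ν => contDiff_pi.2 fun x => ?_
  have hexp : ContDiff ℝ n (exp : 𝔄 → 𝔄) :=
    contDiff_iff_contDiffAt.2 fun a => (exp_analytic (𝕂 := ℝ) a).contDiffAt
  simpa only [Function.comp_def] using hexp.comp (contDiff_apply_apply ℝ 𝔄 ν x)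

/-- **`d(exp iB)|_{B=0} = id`** (the first line of (4.8) to first order: `exp iB = 1 + iB + …`). [folklore] -/
theorem hasFDerivAt_expChart_zero :
    HasFDerivAt (fun B : Λ → T → 𝔄 => fun ν x => exp (B ν x)) (ContinuousLinearMap.id ℝ (Λ → T → 𝔄)) 0 := by
  refine hasFDerivAt_pi'.2 fun ν => hasFDerivAt_pi'.2 fun x => ?_
  have he : HasFDerivAt (fun B : Λ → T → 𝔄 => B ν x)
      ((ContinuousLinearMap.proj (R := ℝ) (φ := fun _ : T => 𝔄) x).comp
        (ContinuousLinearMap.proj (R := ℝ) (φ := fun _ : Λ => T → 𝔄) ν)) 0 :=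
    ((ContinuousLinearMap.proj (R := ℝ) (φ := fun _ : T => 𝔄) x).comp
      (ContinuousLinearMap.proj (R := ℝ) (φ := fun _ : Λ => T → 𝔄) ν)).hasFDerivAt
  have hexp : HasFDerivAt (exp : 𝔄 → 𝔄) (1 : 𝔄 →L[ℝ] 𝔄) ((fun B : Λ → T → 𝔄 => B ν x) 0) :=
    hasFDerivAt_exp_zero (𝕂 := ℝ)
  have h := hexp.comp (0 : Λ → T → 𝔄) he
  refine (h.congr_fderiv ?_ : HasFDerivAt (fun B : Λ → T → 𝔄 => exp (B ν x)) _ 0)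
  ext B
  simp

/-- **The Hessian of `B ↦ 𝐄(exp iB)` at `B = 0` equals the Hessian of `𝐄` at `V = 1`, GIVEN (4.14)** (p. 284): by
the chain rule `D(𝐄∘exp)(B) = D𝐄(exp B) ∘ Dexp(B)` near `0`; differentiating once more at `0`, the term carrying
the second derivative of the chart is `D𝐄(1) ∘ D²exp(0) = 0` by (4.14), and `Dexp(0) = id`.  This is why print may
write the identities (4.13)–(4.15) «at B = 0» indifferently in the field `V` or in `B = (1/i) log V`.
[cite: Balaban1987RG1, (4.13)-(4.15) p.284] -/
theorem hessian_comp_expChart_zero {ℰ : (Λ → T → 𝔄) → F} (hℰ : ContDiffAt ℝ 2 ℰ 1) (h414 : fderiv ℝ ℰ 1 = 0)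
    (u w : Λ → T → 𝔄) :
    fderiv ℝ (fderiv ℝ (fun B : Λ → T → 𝔄 => ℰ (fun ν x => exp (B ν x)))) 0 u w =
      fderiv ℝ (fderiv ℝ ℰ) 1 u w := by
  set Φ : (Λ → T → 𝔄) → Λ → T → 𝔄 := fun B ν x => exp (B ν x) with hΦ
  show fderiv ℝ (fderiv ℝ (fun B : Λ → T → 𝔄 => ℰ (Φ B))) 0 u w = fderiv ℝ (fderiv ℝ ℰ) 1 u w
  have hC : ContDiff ℝ 2 Φ := contDiff_expChart
  have hΦ0 : Φ 0 = 1 := expChart_zero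
  have hΦD : HasFDerivAt Φ (ContinuousLinearMap.id ℝ (Λ → T → 𝔄)) 0 := hasFDerivAt_expChart_zero
  have hcont : Tendsto Φ (𝓝 0) (𝓝 1) := by
    have h := hC.continuous.tendsto (0 : Λ → T → 𝔄)
    rwa [hΦ0] at h
  have hdiff : ∀ᶠ W in 𝓝 (1 : Λ → T → 𝔄), DifferentiableAt ℝ ℰ W := by
    filter_upwards [hℰ.eventually (by simp)] with W hW
    exact hW.differentiableAt (by simp)
  have hdE : ∀ B : Λ → T → 𝔄, DifferentiableAt ℝ Φ B := fun B => hC.differentiable (by simp) B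
  have hchain : ∀ᶠ B in 𝓝 (0 : Λ → T → 𝔄),
      fderiv ℝ (fun B => ℰ (Φ B)) B = (fderiv ℝ ℰ (Φ B)).comp (fderiv ℝ Φ B) := by
    filter_upwards [hcont.eventually hdiff] with B hB
    exact fderiv_fun_comp (x := B) hB (hdE B)
  have hEq : fderiv ℝ (fderiv ℝ (fun B => ℰ (Φ B))) 0 =
      fderiv ℝ (fun B => (fderiv ℝ ℰ (Φ B)).comp (fderiv ℝ Φ B)) 0 :=
    Filter.EventuallyEq.fderiv_eq hchain
  have hc : HasFDerivAt (fun B : Λ → T → 𝔄 => fderiv ℝ ℰ (Φ B))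
      ((fderiv ℝ (fderiv ℝ ℰ) 1).comp (ContinuousLinearMap.id ℝ (Λ → T → 𝔄))) 0 := by
    have h1 : HasFDerivAt (fderiv ℝ ℰ) (fderiv ℝ (fderiv ℝ ℰ) 1) (Φ 0) := by
      rw [hΦ0]
      exact ((hℰ.fderiv_right (m := 1) le_rfl).differentiableAt (by simp)).hasFDerivAt
    -- (the fully explicit form: with the codomain left implicit the elaborator does not unify the product
    -- topological-module structure of `Λ → T → 𝔄` with the one underlying its normed structure)
    exact @HasFDerivAt.comp ℝ _ (Λ → T → 𝔄) _ _ (Λ → T → 𝔄) _ _ ((Λ → T → 𝔄) →L[ℝ] F) _ _ Φ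
      (ContinuousLinearMap.id ℝ _) (0 : Λ → T → 𝔄) (fderiv ℝ ℰ) (fderiv ℝ (fderiv ℝ ℰ) 1) h1 hΦD
  have hd : HasFDerivAt (fun B : Λ → T → 𝔄 => fderiv ℝ Φ B) (fderiv ℝ (fderiv ℝ Φ) 0) 0 :=
    ((hC.contDiffAt.fderiv_right (m := 1) le_rfl).differentiableAt (by simp)).hasFDerivAt
  rw [hEq, (hc.clm_comp hd).fderiv]
  have hE0 : fderiv ℝ ℰ (Φ 0) = 0 := by rw [hΦ0, h414]
  simp [hE0, hΦD.fderiv]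

/-- `B ↦ 𝐄(exp iB)` is `Cⁿ` if `𝐄` is. [folklore] -/
theorem contDiff_comp_expChart {ℰ : (Λ → T → 𝔄) → F} {n : WithTop ℕ∞} (hℰ : ContDiff ℝ n ℰ) :
    ContDiff ℝ n (fun B : Λ → T → 𝔄 => ℰ (fun ν x => exp (B ν x))) :=
  hℰ.comp contDiff_expChart

variable [AddCommGroup T]

/-- **(4.7) + (4.14) ⇒ (4.15)₁ AT `B = 0` IN THE EXPONENTIAL CHART — the hypothesis `h415` of `…B12Ward59`
DISCHARGED from the concrete gauge action**: for `𝐄` `C²` at `V = 1`, invariant under the gauge flows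
`V ↦ (v_t(b₋)V(b)v_t(b₊)⁻¹)_b`, `v_t = exp(tλ)`, near `V = 1` for small `t` and every gauge function `λ` ((4.7)),
and with (4.14) `D𝐄(1) = 0`: `D²[B ↦ 𝐄(exp iB)](0)(B₁, ∂λ) = 0` for all `B₁`, `λ` — «We obtain the following set
of Ward-Takahashi identities ⟨(δ²/δB²)𝐄(1), B₁, ∂λ⟩ = 0, … for an arbitrary gauge function λ, and arbitrary gauge
fields B₁».  [cite: Balaban1987RG1, (4.7) p.282, (4.9) p.283, (4.14)-(4.15) p.284] -/
theorem h415_of_gaugeInvariance {ℰ : (Λ → T → 𝔄) → F} (e : Λ → T) (hℰ : ContDiffAt ℝ 2 ℰ 1)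
    (h47 : ∀ lam : T → 𝔄, ∀ᶠ W in 𝓝 (1 : Λ → T → 𝔄), ∀ᶠ t in 𝓝 (0 : ℝ),
      ℰ (fun ν x => exp (t • lam x) * W ν x * exp (-(t • lam (x + e ν)))) = ℰ W)
    (h414 : fderiv ℝ ℰ 1 = 0) (u : Λ → T → 𝔄) (lam : T → 𝔄) :
    fderiv ℝ (fderiv ℝ (fun B : Λ → T → 𝔄 => ℰ (fun ν x => exp (B ν x)))) 0 u
      (fun ν y => lam (y + e ν) - lam y) = 0 := by
  rw [hessian_comp_expChart_zero hℰ h414]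
  exact hessian_one_apply_grad_eq_zero e hℰ h47 h414 u lam

end Chart

/-! ## §4. By-name composition with the lineage: (4.7) + (4.14) + (5.1) + (5.2) ⇒ (5.9) for the limit tensor -/

section Functional

variable {𝔄 : Type*} [NormedRing 𝔄] [NormedAlgebra ℝ 𝔄] [CompleteSpace 𝔄]
  {d : ℕ} {P : Fin d → Fin d → Pt d → Pt d → ℝ} {ι : Type*} {l : Filter ι} [l.NeBot] {Tn : ι → Type*}
  [∀ n, AddCommGroup (Tn n)] [∀ n, Fintype (Tn n)] [∀ n, DecidableEq (Tn n)]

/-- **(5.9) for the limit tensor with the Ward hypothesis `h415` of `…B12Ward59.eq59_of_limit_of_gaugeInvariance`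
REPLACED by the gauge invariance (4.7) of the finite-volume functionals and (4.14)**: per volume `n` a `C²`
function `𝐄 n` of the gauge field `V : Fin d → Tn n → 𝔄` (print's `𝐄^{(j)}(U_j(V))`), invariant under the gauge
flows near `V = 1` ((4.7), `h47`, bonds `(y, y + π_n e_ν)`) and under translations ((5.2), `hℰtransl`), with (4.14)
`D𝐄 n(1) = 0`; `Πv n` the Hessian kernel at `B = 0` of `B ↦ 𝐄 n(exp iB)` (print's «(δ²/δB²)𝐄(U(exp iB))|_{B=0}»,
(5.1)) in the charge direction `v`, and the pointwise limit (5.1) `Π` ⇒ (5.9)₁ `WardFirst K`, (5.9)₂, and their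
complex readings, for `K = Π(·, 0)`.
[cite: Balaban1987RG1, (4.7) p.282, (4.14)-(4.15) p.284, (5.1)-(5.2) p.292, (5.8)-(5.9) p.293] -/
theorem eq59_of_limit_of_gaugeInvariance47 (π : ∀ n, Pt d →+ Tn n) {ℰ : ∀ n, (Fin d → Tn n → 𝔄) → ℝ}
    (hℰ : ∀ n, ContDiff ℝ 2 (ℰ n)) (v : 𝔄) {Pv : ∀ n, Fin d → Fin d → Tn n → Tn n → ℝ}
    (hH : ∀ n μ ν x y, Pv n μ ν x y =
      fderiv ℝ (fderiv ℝ (fun B : Fin d → Tn n → 𝔄 => ℰ n (fun κ z => exp (B κ z)))) 0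
        (Pi.single μ (Pi.single x v)) (Pi.single ν (Pi.single y v)))
    (hlim : ∀ μ ν x y, Tendsto (fun n => Pv n μ ν (π n x) (π n y)) l (𝓝 (P μ ν x y)))
    (hℰtransl : ∀ n (a : Tn n) (V : Fin d → Tn n → 𝔄), ℰ n (fun μ y => V μ (y - a)) = ℰ n V)
    (h47 : ∀ n (lam : Tn n → 𝔄), ∀ᶠ W in 𝓝 (1 : Fin d → Tn n → 𝔄), ∀ᶠ t in 𝓝 (0 : ℝ),
      ℰ n (fun ν y => exp (t • lam y) * W ν y * exp (-(t • lam (y + π n (unitVec ν))))) = ℰ n W)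
    (h414 : ∀ n, fderiv ℝ (ℰ n) 1 = 0) :
    WardFirst (fun μ ν z => P μ ν z 0) ∧ (∀ μ z, ∑ ν, (P μ ν (z + unitVec ν) 0 - P μ ν z 0) = 0) ∧
      WardB (ofRealK fun μ ν z => P μ ν z 0) ∧ WardB₂ (ofRealK fun μ ν z => P μ ν z 0) :=
  eq59_of_limit_of_gaugeInvariance π (f := fun n B => ℰ n (fun κ z => exp (B κ z)))
    (fun n => contDiff_comp_expChart (hℰ n)) v hH hlim
    (fun n a B => hℰtransl n a (fun κ z => exp (B κ z)))
    (fun n u lam => h415_of_gaugeInvariance (fun ν => π n (unitVec ν)) ((hℰ n).contDiffAt) (h47 n) (h414 n)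
      u lam)

end Functional

end Literature.MathematicalPhysics.QuantumFieldTheory.Balaban1983to89.B12GaugeInv47
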